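import Summits.Langlands.Langlands.Theses.DyadicOddResidue
import Literature.NumberTheory.Automorphic.LocalComponentBJGenericProofs
import Literature.NumberTheory.Automorphic.RankinSelbergLocalUniqueness

/-!
# Sketch — crux stmt-Langlands-18745 `DyadicOddResidue.SectorComplement`, idea `reciprocity-rigidity`
(crux-ideate round 1, ideator 1).  First lemmas of the line, stated over existing declarations,
plus the PURE-LOGIC transport they feed (proved here, no sorry), so that the only `sorry` is the
local theorem `RecRigidityGeneric` (Henniart 1993 / JPSS 1983 rigidity of PINNED data on generic
classes) — the lever of the card.
-/

noncomputable section

set_option linter.dupNamespace false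

open scoped MatrixGroups NumberField
open NumberField IsDedekindDomain Filter
open Literature.NumberTheory.Automorphic Literature.NumberTheory.GaloisRepresentations
open Summit.Langlands
open Summit.Langlands.Langlands.Theses.DyadicOddResidue

namespace Summit.Langlands.Langlands.Cruxes.SectorComplement.ReciprocityRigidity

/-- **R_gen — rigidity of pinned reciprocity data on generic classes** (the LOCAL theorem of the
line; Henniart 1993 Thm. 1.1 on supercuspidals = the tree's named fact `localLanglands_gl`, plus
the JPSS multisegment recovery on generic non-supercuspidal classes): two reciprocity data of a
number field — both normalised against THE Artin maps by the pins `llc_isCanonical`,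
`llc_eps_isCanonical` — have the same `rec_n` on every generic class of every completion. -/
def RecRigidityGeneric : Prop :=
  ∀ (K : Type) [Field K] [NumberField K] (𝓡 𝓡' : ReciprocityData K)
    (v : HeightOneSpectrum (𝓞 K)) (n : ℕ) (πv : SmoothIrrep (GL (Fin n) (v.adicCompletion K)))
    (ψ : AddChar (v.adicCompletion K) Circle), ψ.IsContinuousNontrivial → IsGeneric πv.ρ ψ →
      (𝓡.llc v).recGL n (IrrClass.mk πv) = (𝓡'.llc v).recGL n (IrrClass.mk πv)

/-- **R — what the summit actually needs**: the two data agree on the local components of cuspidal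
automorphic representations of `GL_n(𝔸_K)`, `n ≥ 1`. -/
def RecRigidityOnLocalComponents : Prop :=
  ∀ (K : Type) [Field K] [NumberField K] (𝓡 𝓡' : ReciprocityData K) (n : ℕ)
    (hcpt : isCompact_glFiniteIntegralLevel n K), 0 < n →
    ∀ (π : CuspidalAutomorphicRepData n K hcpt) (v : HeightOneSpectrum (𝓞 K))
      (πv : SmoothIrrep (GL (Fin n) (v.adicCompletion K))), π.1.HasLocalComponentAt v πv.ρ →
        (𝓡.llc v).recGL n (IrrClass.mk πv) = (𝓡'.llc v).recGL n (IrrClass.mk πv)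

/-- R_gen ⇒ R, by the IN-TREE genericity of local components of cuspidal `π`
(`CuspidalAutomorphicRepData.exists_isGeneric_of_hasLocalComponentAt`, Shalika 1974 / Cogdell 2004). -/
theorem recRigidityOnLocalComponents_of_generic (h : RecRigidityGeneric) :
    RecRigidityOnLocalComponents := by
  intro K _ _ 𝓡 𝓡' n hcpt hn π v πv hπv
  haveI : NeZero n := ⟨hn.ne'⟩
  obtain ⟨ψ, hψ, hg⟩ := π.exists_isGeneric_of_hasLocalComponentAt v πv.ρ πv.isSmooth hπv
  exact h K 𝓡 𝓡' v n πv ψ hψ hg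

variable {K : Type} [Field K] [NumberField K] {n : ℕ} {hcpt : isCompact_glFiniteIntegralLevel n K}
  {ℓ : ℕ} [Fact ℓ.Prime]

/-- Transport of local–global compatibility along rigid data (the `p`-adic Hodge datum
`ReciprocityData.pst` is pinned, hence `𝓡`-independent by `rfl`). -/
theorem localGlobalCompatibleAt_transport (h : RecRigidityOnLocalComponents) (𝓡 𝓡' : ReciprocityData K)
    (hn : 0 < n) (ι : PadicAlgCl ℓ ≃+* ℂ) (π : CuspidalAutomorphicRepData n K hcpt)
    (ρ : FramedGaloisRep K (PadicAlgCl ℓ) n) (v : HeightOneSpectrum (𝓞 K))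
    (hL : LocalGlobalCompatibleAt 𝓡 ι π.1 ρ v) : LocalGlobalCompatibleAt 𝓡' ι π.1 ρ v := by
  obtain ⟨πv, r, rℂ, hπv, hlad, hpst, htr, hcls⟩ := hL
  refine ⟨πv, r, rℂ, hπv, hlad, hpst, htr, ?_⟩
  rw [← h K 𝓡 𝓡' n hcpt hn π v πv hπv]
  exact hcls

/-- Transport of `Corresponds`. -/
theorem corresponds_transport (h : RecRigidityOnLocalComponents) (𝓡 𝓡' : ReciprocityData K)
    (hn : 0 < n) (ι : PadicAlgCl ℓ ≃+* ℂ) (π : CuspidalAutomorphicRepData n K hcpt)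
    (ρ : FramedGaloisRep K (PadicAlgCl ℓ) n) (hc : Corresponds 𝓡 ι π.1 ρ) : Corresponds 𝓡' ι π.1 ρ :=
  ⟨hc.1, fun v ↦ localGlobalCompatibleAt_transport h 𝓡 𝓡' hn ι π ρ v (hc.2 v)⟩

omit [NumberField K] in
/-- `IsGeometricFramed` does not see `𝓡` at all (pinned datum). -/
theorem isGeometricFramed_transport [NumberField K] (𝓡 𝓡' : ReciprocityData K)
    (ρ : FramedGaloisRep K (PadicAlgCl ℓ) n) (hg : IsGeometricFramed 𝓡 ρ) : IsGeometricFramed 𝓡' ρ :=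
  hg

/-- Transport of the whole correspondence `(A) ∧ (B)` in rank `n ≥ 1`. -/
theorem globalLanglands_transport (h : RecRigidityOnLocalComponents) (𝓡 𝓡' : ReciprocityData K)
    (hn : 0 < n) (hG : GlobalLanglandsCorrespondenceGLn n K 𝓡 hcpt) :
    GlobalLanglandsCorrespondenceGLn n K 𝓡' hcpt := by
  obtain ⟨hA, hB⟩ := hG
  refine ⟨fun π hLalg ℓ _ ι ↦ ?_, fun ℓ _ ι ρ hirr hgeo ↦ ?_⟩
  · obtain ⟨ρ, hirr, hgeo, hcorr, huniq⟩ := hA π hLalg ℓ ι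
    exact ⟨ρ, hirr, hgeo, corresponds_transport h 𝓡 𝓡' hn ι π ρ hcorr,
      fun ρ' hcorr' ↦ huniq ρ' (corresponds_transport h 𝓡' 𝓡 hn ι π ρ' hcorr')⟩
  · obtain ⟨π, hLalg, hcorr⟩ := hB ℓ ι ρ hirr hgeo
    exact ⟨π, hLalg, corresponds_transport h 𝓡 𝓡' hn ι π ρ hcorr⟩

/-- **The `∃`-shaped summit** — the text every landed seam in the tree concludes
(`IrreducibleOffSector.langlands_of_reciprocityUpToIrreducibility_text_of_JS`,
`CapacityClassicalitySectorToLanglands.sectorToLanglands_of_leaves`, `PrimeSwitchSplit.closes`):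
ONE reciprocity datum per number field for which `(A) ∧ (B)` hold in every rank. -/
def LanglandsExists : Prop :=
  ∀ (F : Type) [Field F] [NumberField F], ∃ 𝓡 : ReciprocityData F, ∀ n : ℕ, 0 < n →
    ∀ hcpt : isCompact_glFiniteIntegralLevel n F, GlobalLanglandsCorrespondenceGLn n F 𝓡 hcpt

/-- **Under rigidity the 2026-08-16 re-type `∃ 𝓡 ↦ Nonempty ∧ ∀ 𝓡` is undone**:
`Langlands ↔ LanglandsExists`. -/
theorem langlands_iff_exists (h : RecRigidityOnLocalComponents) : _root_.Langlands ↔ LanglandsExists := by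
  constructor
  · intro hL F _ _
    obtain ⟨⟨𝓡⟩, hall⟩ := hL F
    exact ⟨𝓡, hall 𝓡⟩
  · intro hE F _ _
    obtain ⟨𝓡, h𝓡⟩ := hE F
    exact ⟨⟨𝓡⟩, fun 𝓡' n hn hcpt ↦ globalLanglands_transport h 𝓡 𝓡' hn (h𝓡 n hn hcpt)⟩

/-- **TRANSFER for the crux**: `C⁺ := R ∧ (X → LanglandsExists)` implies `C = SectorComplement`
(concludes the route decl BY NAME). `X → LanglandsExists` is the `∃`-form of the junction, i.e. the
conclusion shape of the shared seam `W → B_w → LGC_∃ → JS (2.2) → JS (2.3) → ·`. -/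
theorem sectorComplement_of_transfer (h : RecRigidityOnLocalComponents)
    (hC : OddRegularReciprocityQ → LanglandsExists) : SectorComplement :=
  fun hX ↦ (langlands_iff_exists h).2 (hC hX)

/-- … and the transfer loses nothing: `C → (X → LanglandsExists)` outright. -/
theorem transfer_of_sectorComplement (h : RecRigidityOnLocalComponents) (hC : SectorComplement) :
    OddRegularReciprocityQ → LanglandsExists :=
  fun hX ↦ (langlands_iff_exists h).1 (hC hX)

/-- **First lemma of the line, local side (a): the pins identify the normalising data** — two pinned
local Langlands data of a completion have the same Artin datum (structure equality, not only the
underlying homomorphism). -/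
theorem artinData_eq (𝓡 𝓡' : ReciprocityData K) (v : HeightOneSpectrum (𝓞 K)) :
    (𝓡.llc v).artin = (𝓡'.llc v).artin := by
  have h := 𝓡.artin_eq 𝓡' v
  rcases h𝓡 : (𝓡.llc v).artin with ⟨a, h1, h2, h3, h4⟩
  rcases h𝓡' : (𝓡'.llc v).artin with ⟨a', h1', h2', h3', h4'⟩
  rw [h𝓡, h𝓡'] at h
  cases h
  rfl

/-- **First lemma of the line, local side (b)** (the stub that carries the lever; statement only):
agreement on SUPERCUSPIDAL classes is the named fact `localLanglands_gl` (Henniart 1993, Thm. 1.1)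
once (a) and `localEpsilonSystem_unique` identify `(d, 𝓔)`; the generic non-supercuspidal classes
are the JPSS multisegment recovery. -/
theorem recRigidityGeneric_holds : RecRigidityGeneric := by
  sorry


/-! ## The engine of the recovery argument, PROVED: the typed clauses already force the pair
Euler factors of ANY two local Langlands data to agree on generic pairs (no pin needed here —
`lFactor_pairs` does not mention `d`, `𝓔`; existence of the RS factor is the `←` of the clause,
uniqueness is the proved `HasRSLFactor.unique`). -/

section Engine

open MeasureTheory

variable {F : Type} [Field F] [ValuativeRel F] [TopologicalSpace F] [IsNonarchimedeanLocalField F]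

/-- **Pair Euler factors are datum-independent on generic pairs.** For two local Langlands data
`L, L'` of `F`, a generic `π ∈ Irr GL_n(F)`, a generic `π' ∈ Irr GL_m(F)`, `1 ≤ m < n`, and any
invariant Radon measure `ν` on `GL_m(F) ⧸ U_m` (needed only to instantiate the clause):
`eulerFactor(rec π ⊗ rec π') = eulerFactor(rec' π ⊗ rec' π')`. -/
theorem eulerFactor_pair_eq (L L' : LocalLanglandsDatum F) {m n : ℕ} (hm : 0 < m) (hmn : m < n)
    (π : SmoothIrrep (GL (Fin n) F)) (π' : SmoothIrrep (GL (Fin m) F)) (ψ : AddChar F Circle)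
    (hψ : ψ.IsContinuousNontrivial) (hg : IsGeneric π.ρ ψ) (hg' : IsGeneric π'.ρ ψ⁻¹)
    [MeasurableSpace (GL (Fin m) F ⧸ upperUnitriangular (Fin m) F)]
    [BorelSpace (GL (Fin m) F ⧸ upperUnitriangular (Fin m) F)]
    (ν : Measure (GL (Fin m) F ⧸ upperUnitriangular (Fin m) F))
    [SMulInvariantMeasure (GL (Fin m) F) (GL (Fin m) F ⧸ upperUnitriangular (Fin m) F) ν]
    [IsFiniteMeasureOnCompacts ν] [ν.IsOpenPosMeasure] :
    (((L.recGL n (IrrClass.mk π)).out.1).tprod ((L.recGL m (IrrClass.mk π')).out.1)).eulerFactor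
        L.hn L.hex =
      (((L'.recGL n (IrrClass.mk π)).out.1).tprod ((L'.recGL m (IrrClass.mk π')).out.1)).eulerFactor
        L'.hn L'.hex := by
  have h1 : HasRSLFactor hmn π.ρ π'.ρ ψ ν
      ((((L.recGL n (IrrClass.mk π)).out.1).tprod ((L.recGL m (IrrClass.mk π')).out.1)).eulerFactor
        L.hn L.hex) :=
    (L.isLocalLanglands.lFactor_pairs hm hmn π π' ψ hψ hg hg' ν _).2 rfl
  have h2 : HasRSLFactor hmn π.ρ π'.ρ ψ ν
      ((((L'.recGL n (IrrClass.mk π)).out.1).tprod ((L'.recGL m (IrrClass.mk π')).out.1)).eulerFactor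
        L'.hn L'.hex) :=
    (L'.isLocalLanglands.lFactor_pairs hm hmn π π' ψ hψ hg hg' ν _).2 rfl
  exact h1.unique h2

end Engine

end Summit.Langlands.Langlands.Cruxes.SectorComplement.ReciprocityRigidity

end
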